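import Literature.MathematicalPhysics.QuantumFieldTheory.Balaban1983to89.B9Thm314WholeCancellation

/-!
# `Balaban1983to89.B9Thm314WholeCancellationLayer` — [B9] Theorem 3.14 (pp. 426–427): ROWS 22–23 AT NODE 00's LAYER OF LETTERS WITH THE
# CANCELLATION READING PROVED — the knit's `hdom` at `(operatorLayerYOfLetters 𝔸 G x 𝔏 𝔈).Kdiff` from the located approximation identity

T. Bałaban, *Propagators for lattice gauge theories in a background field*, Commun. Math. Phys. **99** (1985) 389–434
[`Balaban1985BackgroundPropagators`, "B9"].

statement-level skeleton of published theorems with citation tags; proofs where landed; nothing here is a claim about the Yang–Mills mass gap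

THE PRINTED LOCUS (verbatim, p. 427, proof of Theorem 3.14): *"We take random walk expansions for both operators. Terms of these expansions
are the same for walks which have all localizations contained in Ω, or Ω^{(k)}, thus in the difference they are cancelled and we have walks
with at least one localization intersecting Ωᶜ. For such ω we have d(ω, y, y′) ≥ d(y, y′, Ω). This remark, the estimates (3.108) and the
corresponding estimates for other norms, give the inequalities of the above theorem."*

THE POINT.  `B9Thm314WholeCancellation.dominatedBySums_kernelFamilyB` proves the domination reading of rows 22–23 at NODE 00's bond-sector
reading for any letter, walk-term letters and walk sets.  THIS FILE specialises it to THE PAIR of expansions (n06-m g2∕g3: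
`B9Thm314WholePair.pairExpansion`, `B9Thm314WholePairWalks.pairWalkSets`) and to def-Y's layer:
* `pairOp P₁ P₂ T₁ T₂` — the walk-term letters of the difference (Sum.elim; the sign of the second expansion's terms is carried by `T₂`);
  `pairTermK_kernelFamilyB` (the inherited families ARE the readings of the inherited letters, `rfl` by cases); `dominatedBySums_pair_kernelFamilyB`;
* ★ `hdom_layerOfLetters` — the knit's binder `hdom` (n06-d g3, `…allPins_r12pairI`) at `(operatorLayerYOfLetters 𝔸 G x 𝔏 𝔈).Kdiff` with the
  walk-term families PINNED as `fun ω => kernelFamilyB x.toKIdx (bg9Y 𝔸 G x) (fun U => U) (Tᵢ ω) 𝔏.parB`, from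
  `ExpansionReads x.toKIdx (fun U => U) 𝔏.Kdiff (pairOp … T₁ T₂) W U`;
* ★ `thm314_pair_layerOfLetters` — rows 22 ∧ 23 (`B9.Thm314Printed` ∧ `B9Thm314.Thm314LocalPrinted`) for the family
  `fun x => (operatorLayerYOfLetters 𝔸 G x (𝔏 x) (𝔈 x)).Kdiff` from: the two Theorem-3.10 all-norms leaves about the readings of `T₁ T₂`, the
  geometry (`D₁ X₂ Meets₂`, laws), `hr` (flag T314 (ii) STANDS), the model signs, d(·,·,Ω) ≥ 0, the per-sequence walk sets with `WalkSetsSpec` ∕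
  `WalkWeightsSummable`, and the located identity `hexp` under «both expansions converge at U».

HONEST SCOPE.  The inequality-transfer reading `hdom` is DISCHARGED; displayed in its place is the approximation identity of printed shape for the
letter `𝔏.Kdiff` (the cancellation of p. 427 in operator form — GAPS G-B9-08); nothing of print asserted; no expansion constructed; NOT a node discharge, NOT summit progress; one finite lattice
paper; nothing continuum, nothing about the mass gap.  Cell `pub-ymgap` (D-0062), node N06 [B9], N06-ASSIGNMENT v1 rows 22–23 (successor file of
bundle F8), seat `pub-ymgap-dag-n06-m` (g3), 2026-08-27.
-/

noncomputable section

namespace Literature.MathematicalPhysics.QuantumFieldTheory.Balaban1983to89.B9Thm314WholeCancellationLayer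

open Finset
open B6KLevelCensusIndexV1 (KIdx)
open B9GeoNormsKLevelV1 (geo9K)
open Node00 (FBondY CfgY BondOpY BondParY kernelFamilyB)
open B9Thm314WholeReadingCalculus B9Thm314WholeExpansionReads B9Thm314WholeCancellation
open B9Thm314WholeSummation (DominatedBySums)
open B9Thm314WholePair (pairExpansion pairTermK)
open B9Thm314WholePairWalks (pairWalkSets)

variable {d ℓ : ℕ} {hd : 1 ≤ d + 1} {hL : Odd (ℓ + 1) ∧ 1 < ℓ + 1} {b₀ b₁ : ℝ}
variable {𝔸 : Type} [NormedRing 𝔸] [NormedAlgebra ℂ 𝔸] [CompleteSpace 𝔸]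

/-! ## §1 The pair of expansions -/

section Pair

variable {i : KIdx d ℓ hd hL b₀ b₁} {B : B9.Backgrounds} {E₁ E₂ : B9.RWExpansion (geo9K i) B}

/-- **THE WALK-TERM LETTERS OF THE DIFFERENCE** over the pair expansion `pairExpansion E₁ E₂ P₁ P₂`: the first sequence's letters on its
surviving walks, the second sequence's on its (the sign of p. 427's «difference» is carried by `T₂` itself — the norm functionals are even).
[cite: Balaban1985BackgroundPropagators, Thm 3.14 proof p.427] -/
def pairOp (P₁ : E₁.Walk → Prop) (P₂ : E₂.Walk → Prop) (T₁ : E₁.Walk → BondOpY 𝔸 i) (T₂ : E₂.Walk → BondOpY 𝔸 i) :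
    (pairExpansion E₁ E₂ P₁ P₂).Walk → BondOpY 𝔸 i :=
  Sum.elim (fun ω => T₁ ω.1) (fun ω => T₂ ω.1)

/-- the inherited walk-term families of the readings ARE the readings of the inherited letters (by cases, `rfl`).
[cite: Balaban1985BackgroundPropagators, Thm 3.14 proof p.427 + (3.108) p.416, bookkeeping] -/
theorem pairTermK_kernelFamilyB (cfg : B.Cfg → CfgY 𝔸 i) (par : BondParY 𝔸 i) (P₁ : E₁.Walk → Prop) (P₂ : E₂.Walk → Prop)
    (T₁ : E₁.Walk → BondOpY 𝔸 i) (T₂ : E₂.Walk → BondOpY 𝔸 i) :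
    pairTermK E₁ E₂ P₁ P₂ (fun ω => kernelFamilyB i B cfg (T₁ ω) par) (fun ω => kernelFamilyB i B cfg (T₂ ω) par) =
      fun ω => kernelFamilyB i B cfg (pairOp P₁ P₂ T₁ T₂ ω) par := by
  funext ω
  rcases ω with ω | ω
  · rfl
  · rfl

variable [FiniteDimensional ℂ 𝔸]

/-- ★ **THE DOMINATION READING OF THE PAIR**: if the letter `O` is read on the read sets through the pair's walk-term letters
`pairOp P₁ P₂ T₁ T₂` and walk sets `W`, then `kernelFamilyB … O par` is dominated by the partial sums of the inherited families `pairTermK …`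
of the two readings. [cite: Balaban1985BackgroundPropagators, Thm 3.14 proof p.427] -/
theorem dominatedBySums_pair_kernelFamilyB {cfg : B.Cfg → CfgY 𝔸 i} {O : BondOpY 𝔸 i} (par : BondParY 𝔸 i)
    {P₁ : E₁.Walk → Prop} {P₂ : E₂.Walk → Prop} {T₁ : E₁.Walk → BondOpY 𝔸 i} {T₂ : E₂.Walk → BondOpY 𝔸 i}
    {W : ℕ → (geo9K i).Site → (geo9K i).Site → Finset (pairExpansion E₁ E₂ P₁ P₂).Walk} {U : B.Cfg}
    (hR : ExpansionReads i cfg O (pairOp P₁ P₂ T₁ T₂) W U) :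
    DominatedBySums (pairExpansion E₁ E₂ P₁ P₂)
      (pairTermK E₁ E₂ P₁ P₂ (fun ω => kernelFamilyB i B cfg (T₁ ω) par) (fun ω => kernelFamilyB i B cfg (T₂ ω) par))
      (kernelFamilyB i B cfg O par) W U := by
  rw [pairTermK_kernelFamilyB]
  exact dominatedBySums_kernelFamilyB par hR

end Pair

/-! ## §2 At NODE 00's layer of letters -/

section Layer

open B9PinMembersKLevelV1 (MemberY geo9Y bg9Y)
open Node00 (CovLettersY ExpLettersY operatorLayerYOfLetters)
open B9 B9Thm314 B9Thm314WholePair B9Thm314WholePairWalks B9Thm314WholeSummation B9SectCWalkTermsAllNorms B9FromB6ModelSignsOn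

variable {Mstar : ℕ} {G : Subgroup 𝔸ˣ} [FiniteDimensional ℂ 𝔸]

/-- ★ **THE KNIT's `hdom` AT NODE 00's LAYER OF LETTERS**: at a member `x`, the domination reading of rows 22–23 for
`(operatorLayerYOfLetters 𝔸 G x 𝔏 𝔈).Kdiff` (def-Y's reading `kernelFamilyB … 𝔏.Kdiff 𝔏.parB` of the letter G(Ω, U) − G(Ω′, U)), with the
walk-term families PINNED as the readings of walk-term letters `T₁ T₂`, from the located approximation identity `ExpansionReads` for `𝔏.Kdiff`.
[cite: Balaban1985BackgroundPropagators, Thm 3.14 proof p.427] -/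
theorem hdom_layerOfLetters (x : MemberY d ℓ hd hL b₀ b₁ Mstar) (𝔏 : CovLettersY 𝔸 x) (𝔈 : ExpLettersY 𝔸 G x)
    {E₁ E₂ : B9.RWExpansion (geo9Y x) (bg9Y 𝔸 G x)} (P₁ : E₁.Walk → Prop) (P₂ : E₂.Walk → Prop)
    (T₁ : E₁.Walk → BondOpY 𝔸 x.toKIdx) (T₂ : E₂.Walk → BondOpY 𝔸 x.toKIdx)
    (W : ℕ → (geo9Y x).Site → (geo9Y x).Site → Finset (pairExpansion E₁ E₂ P₁ P₂).Walk) (U : (bg9Y 𝔸 G x).Cfg)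
    (hR : ExpansionReads x.toKIdx (B := bg9Y 𝔸 G x) (fun U => U) 𝔏.Kdiff (pairOp P₁ P₂ T₁ T₂) W U) :
    DominatedBySums (pairExpansion E₁ E₂ P₁ P₂)
      (pairTermK E₁ E₂ P₁ P₂ (fun ω => kernelFamilyB x.toKIdx (bg9Y 𝔸 G x) (fun U => U) (T₁ ω) 𝔏.parB)
        (fun ω => kernelFamilyB x.toKIdx (bg9Y 𝔸 G x) (fun U => U) (T₂ ω) 𝔏.parB))
      (operatorLayerYOfLetters 𝔸 G x 𝔏 𝔈).Kdiff W U :=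
  dominatedBySums_pair_kernelFamilyB 𝔏.parB hR

/-- ★ **ROWS 22 AND 23 AT NODE 00's LAYER OF LETTERS, THE CANCELLATION READING PROVED**: `B9Thm314WholePairWalks.thm314_pair_of_pair_walks`
at `Kdiff := fun x => (operatorLayerYOfLetters 𝔸 G x (𝔏 x) (𝔈 x)).Kdiff` with the walk-term families pinned as the readings of the letters
`T₁ T₂` and `hdom` SUPPLIED by `hdom_layerOfLetters`.  Displayed: the two Theorem-3.10 all-norms leaves `h₁ h₂` (now about the readings of
`T₁ T₂`), the geometry (`D₁ X₂ Meets₂`, laws), the M-uniform diameter bound `hr` (flag T314 (ii) STANDS), the model signs and d(·,·,Ω) ≥ 0, the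
per-sequence walk sets with `WalkSetsSpec`∕`WalkWeightsSummable`, and — in place of the inequality-transfer reading `hdom` — the located
approximation identity `hexp` («the partial sums of ±ω-terms over the touching walks approximate G(Ω, U) − G(Ω′, U) on the read sets», p. 427;
GAPS G-B9-08 in operator form).  Nothing of print asserted; NOT a node discharge. [cite: Balaban1985BackgroundPropagators, Thm 3.14 (3.154) pp.426–427] -/
theorem thm314_pair_layerOfLetters (𝔏 : ∀ x : MemberY d ℓ hd hL b₀ b₁ Mstar, CovLettersY 𝔸 x)
    (𝔈 : ∀ x : MemberY d ℓ hd hL b₀ b₁ Mstar, ExpLettersY 𝔸 G x) {c35 : ℝ}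
    {OmK : ∀ x : MemberY d ℓ hd hL b₀ b₁ Mstar, (geo9Y x).Site → Prop}
    {dOmega : ∀ x : MemberY d ℓ hd hL b₀ b₁ Mstar, (geo9Y x).Site → (geo9Y x).Site → ℝ}
    {Ps : ∀ x : MemberY d ℓ hd hL b₀ b₁ Mstar, (geo9Y x).Loc → Prop}
    {E₁ E₂ : ∀ x : MemberY d ℓ hd hL b₀ b₁ Mstar, RWExpansion (geo9Y x) (bg9Y 𝔸 G x)}
    (T₁ : ∀ x : MemberY d ℓ hd hL b₀ b₁ Mstar, (E₁ x).Walk → BondOpY 𝔸 x.toKIdx)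
    (T₂ : ∀ x : MemberY d ℓ hd hL b₀ b₁ Mstar, (E₂ x).Walk → BondOpY 𝔸 x.toKIdx)
    (D₁ : ∀ x, LocData (geo9Y x) (bg9Y 𝔸 G x) (E₁ x))
    (X₂ : ∀ x, (E₂ x).Walk → ℕ → (geo9Y x).Site → Prop) (Meets₂ : ∀ x, (E₂ x).Walk → ℕ → Prop)
    (L₁ : ∀ x, (D₁ x).Laws (dOmega x)) (L₂ : ∀ x, (locData₂ (D₁ x) (X₂ x) (Meets₂ x)).Laws (dOmega x)) (r₀ : ℝ)
    (hr : ∀ x, (D₁ x).diam ≤ r₀) (S : ∀ x, ModelSignsOn (geo9Y x) (Ps x)) (hdΩ : ∀ x (y y' : (geo9Y x).Site), 0 ≤ dOmega x y y')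
    (h₁ : Thm310AllNormsPrinted c35 geo9Y (bg9Y 𝔸 G) E₁
      (fun x ω => kernelFamilyB x.toKIdx (bg9Y 𝔸 G x) (fun U => U) (T₁ x ω) (𝔏 x).parB))
    (h₂ : Thm310AllNormsPrinted c35 geo9Y (bg9Y 𝔸 G) E₂
      (fun x ω => kernelFamilyB x.toKIdx (bg9Y 𝔸 G x) (fun U => U) (T₂ x ω) (𝔏 x).parB))
    (W₁ : ∀ x, ℕ → (geo9Y x).Site → (geo9Y x).Site → Finset (E₁ x).Walk)
    (W₂ : ∀ x, ℕ → (geo9Y x).Site → (geo9Y x).Site → Finset (E₂ x).Walk)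
    (hW₁ : ∀ x, WalkSetsSpec (E₁ x) (W₁ x)) (hW₂ : ∀ x, WalkSetsSpec (E₂ x) (W₂ x))
    (hcnt₁ : WalkWeightsSummable geo9Y (bg9Y 𝔸 G) E₁ W₁) (hcnt₂ : WalkWeightsSummable geo9Y (bg9Y 𝔸 G) E₂ W₂)
    (hexp : ∀ (x : MemberY d ℓ hd hL b₀ b₁ Mstar) (U : (bg9Y 𝔸 G x).Cfg), (E₁ x).Converges U ∧ (E₂ x).Converges U →
      ExpansionReads x.toKIdx (B := bg9Y 𝔸 G x) (fun U => U) (𝔏 x).Kdiff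
        (pairOp (D₁ x).Touches (locData₂ (D₁ x) (X₂ x) (Meets₂ x)).Touches (T₁ x) (T₂ x))
        (pairWalkSets (W₁ x) (W₂ x) (D₁ x).Touches (locData₂ (D₁ x) (X₂ x) (Meets₂ x)).Touches) U) :
    Thm314Printed c35 geo9Y (bg9Y 𝔸 G) (fun x => (operatorLayerYOfLetters 𝔸 G x (𝔏 x) (𝔈 x)).Kdiff) dOmega ∧
      Thm314LocalPrinted c35 geo9Y (bg9Y 𝔸 G) (fun x => (operatorLayerYOfLetters 𝔸 G x (𝔏 x) (𝔈 x)).Kdiff) OmK dOmega :=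
  thm314_pair_of_pair_walks D₁ X₂ Meets₂ L₁ L₂ r₀ hr S hdΩ h₁ h₂ W₁ W₂ hW₁ hW₂ hcnt₁ hcnt₂
    fun x U hU => hdom_layerOfLetters x (𝔏 x) (𝔈 x) _ _ (T₁ x) (T₂ x) _ U (hexp x U hU)

end Layer

end Literature.MathematicalPhysics.QuantumFieldTheory.Balaban1983to89.B9Thm314WholeCancellationLayer

end
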